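import Mathlib
import HarnessLib
import Literature.Analysis.SpecialFunctions.MatsubaraSum
import Literature.MathematicalPhysics.QuantumLattice.MatsubaraTruncationMidpoint

/-!
# Route `KLProgramme` — ENGINE item stmt-HubbardSuperconductivity-20437, row (C) credit path, GAP G-005 «TADPOLE-NONVANISHING»:
# TWO-SIDED BOUNDS FOR THE TRUNCATED FERMIONIC MATSUBARA TADPOLE SUM (cell gate-hubbard-kl, registrant seat gate-hubbard-kl-p1b g18;
# pen (R426)(B)/(R427)(A): the residual of the (C) credit path is `|c_T| ≥ c₁`, `c_T = (1/βL²)·Σ_k w·(1/β)Σ_ω e_k/(ω²+e_k²)`; pre-staged D-0071-style for the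
# scale-0 lane that owns G-005)

WHAT.  For the truncated frequency set `ωᵢ = (2n+1)π/β`, `n ∈ [−M, M)` (`MatsubaraIdx M`), and a level `ξ`:
* `sum_matsubaraIdx_one_div_sq_add_sq_le_tanh` — the truncated sum is BELOW the full one: `Σᵢ 1/(ωᵢ² + ξ²) ≤ β·tanh(βξ/2)/(2ξ)` (`ξ ≠ 0`; positivity of the
  one-sided series + the tree's `tsum_one_div_matsubara_sq_add_sq`);
* `abs_mul_sum_matsubaraIdx_le_half_tanh`, `abs_mul_sum_matsubaraIdx_le_half` — hence the TADPOLE TERM is bounded by its `M = ∞` value: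
  `|ξ|·Σᵢ 1/(ωᵢ² + ξ²) ≤ (β/2)·tanh(β|ξ|/2) ≤ β/2` (every `ξ`, every `M`);
* `tsum_tail_one_div_matsubara_sq_add_sq_le` — the tail beyond `M ≥ 1` frequencies: `Σ_{n ≥ M} 1/(ω_n² + ξ²) ≤ β²/(2π²M)` (from `1/ω_n² ≤ β²/(4π²n²)` and Mathlib's
  `sum_Ioo_inv_sq_le`);
* `half_tanh_sub_le_mul_sum_matsubaraIdx` — hence the truncated tadpole term is ABOVE its `M = ∞` value minus the tail: for `ξ > 0`, `M ≥ 1`,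
  `(β/2)·tanh(βξ/2) − ξ·β²/(π²M) ≤ ξ·Σᵢ 1/(ωᵢ² + ξ²)`.
So `(1/β)·ξ·Σᵢ 1/(ωᵢ²+ξ²) ∈ [½tanh(βξ/2) − ξβ/(π²M), ½tanh(βξ/2)]` for `ξ > 0` (odd in `ξ`): the per-momentum tadpole term carries the SIGN of `ξ`, is at most `½` in size,
and is within `ξβ/(π²M)` of the midpoint value `½tanh(βξ/2) = ½ − n_F(ξ)` — the Matsubara half of the route to `|c_T| ≥ c₁` (KL STATUS 2026-08-29, p1b g18 «ROUTE v2»).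
Elementary real analysis on the tree's identities; nothing here asserts G-005, (C), any row of 20437, K3, the Kohn–Luttinger margin or superconductivity.  0 kit · 0 lit.
References: BGM 2006 §2.1 (2.2)–(2.5) [cite: BenfattoGiulianiMastropietro2006]; Fetter–Walecka §25 (frequency sums) [folklore].
-/

noncomputable section

namespace Summit.HubbardSuperconductivity.HubbardSuperconductivity.Theorems.MatsubaraTadpole

set_option linter.dupNamespace false -- summit = problem name (single-conjunct summit), D-0017

open Real Finset Literature.MathematicalPhysics.QuantumLattice Literature.Analysis.SpecialFunctions

/-! ## §1 The truncated sum is below the full one -/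

/-- **Truncation from above**: `Σᵢ 1/(ωᵢ² + ξ²) ≤ β·tanh(βξ/2)/(2ξ)` for `ξ ≠ 0` (the right side is the full two-sided Matsubara sum; every term is
nonnegative). -/
theorem sum_matsubaraIdx_one_div_sq_add_sq_le_tanh {β ξ : ℝ} (hβ : 0 < β) (hξ : ξ ≠ 0) (M : ℕ) :
    ∑ i : MatsubaraIdx M, 1 / (matsubaraFreq β M i ^ 2 + ξ ^ 2) ≤ β * Real.tanh (β * ξ / 2) / (2 * ξ) := by
  rw [sum_matsubaraIdx_one_div_sq_add_sq]
  have hs := summable_one_div_matsubara_sq_add_sq hβ ξ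
  have h := sum_le_hasSum (Finset.range M) (fun n _ => by positivity) hs.hasSum
  rw [tsum_one_div_matsubara_sq_add_sq hβ hξ] at h
  calc 2 * ∑ n ∈ Finset.range M, 1 / (((2 * n + 1) * π / β) ^ 2 + ξ ^ 2)
      ≤ 2 * (β * Real.tanh (β * ξ / 2) / (4 * ξ)) := mul_le_mul_of_nonneg_left h (by norm_num)
    _ = β * Real.tanh (β * ξ / 2) / (2 * ξ) := by ring

/-- **The truncated tadpole term is bounded by its `M = ∞` value**: `|ξ|·Σᵢ 1/(ωᵢ² + ξ²) ≤ (β/2)·tanh(β|ξ|/2)` (every `ξ`, every `M`). -/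
theorem abs_mul_sum_matsubaraIdx_le_half_tanh {β : ℝ} (hβ : 0 < β) (ξ : ℝ) (M : ℕ) :
    |ξ| * ∑ i : MatsubaraIdx M, 1 / (matsubaraFreq β M i ^ 2 + ξ ^ 2) ≤ β / 2 * Real.tanh (β * |ξ| / 2) := by
  rcases eq_or_ne ξ 0 with rfl | hξ
  · simp
  have hξa : 0 < |ξ| := abs_pos.2 hξ
  have h := sum_matsubaraIdx_one_div_sq_add_sq_le_tanh hβ hξa.ne' M
  simp_rw [sq_abs] at h
  calc |ξ| * ∑ i : MatsubaraIdx M, 1 / (matsubaraFreq β M i ^ 2 + ξ ^ 2)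
      ≤ |ξ| * (β * Real.tanh (β * |ξ| / 2) / (2 * |ξ|)) := mul_le_mul_of_nonneg_left h hξa.le
    _ = β / 2 * Real.tanh (β * |ξ| / 2) := by field_simp

/-- **… and hence by `β/2`**: `|ξ|·Σᵢ 1/(ωᵢ² + ξ²) ≤ β/2` (`tanh ≤ 1`). -/
theorem abs_mul_sum_matsubaraIdx_le_half {β : ℝ} (hβ : 0 < β) (ξ : ℝ) (M : ℕ) :
    |ξ| * ∑ i : MatsubaraIdx M, 1 / (matsubaraFreq β M i ^ 2 + ξ ^ 2) ≤ β / 2 := by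
  have h := abs_mul_sum_matsubaraIdx_le_half_tanh hβ ξ M
  have ht : Real.tanh (β * |ξ| / 2) ≤ 1 := (Real.tanh_lt_one _).le
  have hβ2 : 0 ≤ β / 2 := by positivity
  calc _ ≤ β / 2 * Real.tanh (β * |ξ| / 2) := h
    _ ≤ β / 2 * 1 := mul_le_mul_of_nonneg_left ht hβ2
    _ = β / 2 := mul_one _

/-- The per-momentum tadpole term in the `(1/β)`-normalised form: `|(1/β)·Σᵢ ξ/(ωᵢ² + ξ²)| ≤ ½`. -/
theorem abs_inv_mul_sum_matsubaraIdx_div_le_half {β : ℝ} (hβ : 0 < β) (ξ : ℝ) (M : ℕ) :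
    |β⁻¹ * ∑ i : MatsubaraIdx M, ξ / (matsubaraFreq β M i ^ 2 + ξ ^ 2)| ≤ 1 / 2 := by
  have h := abs_mul_sum_matsubaraIdx_le_half hβ ξ M
  have hsum : ∑ i : MatsubaraIdx M, ξ / (matsubaraFreq β M i ^ 2 + ξ ^ 2) =
      ξ * ∑ i : MatsubaraIdx M, 1 / (matsubaraFreq β M i ^ 2 + ξ ^ 2) := by
    rw [Finset.mul_sum]
    refine Finset.sum_congr rfl fun i _ => ?_
    rw [mul_one_div]
  have hS : 0 ≤ ∑ i : MatsubaraIdx M, 1 / (matsubaraFreq β M i ^ 2 + ξ ^ 2) :=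
    Finset.sum_nonneg fun i _ => by positivity
  rw [hsum, abs_mul, abs_mul, abs_inv, abs_of_pos hβ, abs_of_nonneg hS]
  rw [inv_mul_le_iff₀ hβ]
  linarith

/-! ## §2 The tail and the truncated sum from below -/

/-- **The tail of the one-sided Matsubara sum**: for `M ≥ 1`, `Σ_{n ≥ 0} 1/(ω_{n+M}² + ξ²) ≤ β²/(2π²M)` (`1/ω_{n+M}² ≤ β²/(4π²(n+M)²)` and
`Σ_{i > M−1} 1/i² ≤ 2/M`, Mathlib's `sum_Ioo_inv_sq_le`). -/
theorem tsum_tail_one_div_matsubara_sq_add_sq_le {β : ℝ} (hβ : 0 < β) (ξ : ℝ) {M : ℕ} (hM : 1 ≤ M) :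
    ∑' n : ℕ, 1 / (((2 * ((n + M : ℕ) : ℝ) + 1) * π / β) ^ 2 + ξ ^ 2) ≤ β ^ 2 / (2 * π ^ 2 * M) := by
  have hπ : 0 < π := Real.pi_pos
  have hM0 : (0 : ℝ) < M := by exact_mod_cast hM
  -- termwise comparison with `β²/(4π²) · 1/(n+M)²`
  have hterm : ∀ n : ℕ, 1 / (((2 * ((n + M : ℕ) : ℝ) + 1) * π / β) ^ 2 + ξ ^ 2) ≤ β ^ 2 / (4 * π ^ 2) * (((n + M : ℕ) : ℝ) ^ 2)⁻¹ := by
    intro n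
    have hnm : (1 : ℝ) ≤ ((n + M : ℕ) : ℝ) := by exact_mod_cast (show 1 ≤ n + M by omega)
    have hpos : 0 < ((2 * ((n + M : ℕ) : ℝ) + 1) * π / β) ^ 2 := by positivity
    calc 1 / (((2 * ((n + M : ℕ) : ℝ) + 1) * π / β) ^ 2 + ξ ^ 2)
        ≤ 1 / (((2 * ((n + M : ℕ) : ℝ) + 1) * π / β) ^ 2) := by
          apply one_div_le_one_div_of_le hpos; nlinarith [sq_nonneg ξ]
      _ ≤ 1 / ((2 * ((n + M : ℕ) : ℝ) * π / β) ^ 2) := by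
          apply one_div_le_one_div_of_le (by positivity)
          have h1 : 0 ≤ 2 * ((n + M : ℕ) : ℝ) * π / β := by positivity
          have h2 : 2 * ((n + M : ℕ) : ℝ) * π / β ≤ (2 * ((n + M : ℕ) : ℝ) + 1) * π / β := by
            apply div_le_div_of_nonneg_right _ hβ.le; nlinarith
          exact pow_le_pow_left₀ h1 h2 2
      _ = β ^ 2 / (4 * π ^ 2) * (((n + M : ℕ) : ℝ) ^ 2)⁻¹ := by
          field_simp
          ring
  -- every finite partial sum of the majorant is `≤ β²/(4π²) · 2/M`
  have hnonneg : 0 ≤ fun n : ℕ => 1 / (((2 * ((n + M : ℕ) : ℝ) + 1) * π / β) ^ 2 + ξ ^ 2) := fun n => by positivity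
  refine Real.tsum_le_of_sum_le hnonneg fun u => ?_
  have hmaj : ∑ n ∈ u, 1 / (((2 * ((n + M : ℕ) : ℝ) + 1) * π / β) ^ 2 + ξ ^ 2) ≤
      β ^ 2 / (4 * π ^ 2) * ∑ n ∈ u, (((n + M : ℕ) : ℝ) ^ 2)⁻¹ := by
    rw [Finset.mul_sum]; exact Finset.sum_le_sum fun n _ => hterm n
  -- reindex `n ↦ n + M` into `Ioo (M−1) K`
  set K : ℕ := u.sup id + M + 1 with hK
  have hsub : u.map (addRightEmbedding M) ⊆ Finset.Ioo (M - 1) K := by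
    intro i hi
    rw [Finset.mem_map] at hi
    obtain ⟨n, hn, rfl⟩ := hi
    simp only [addRightEmbedding_apply, Finset.mem_Ioo]
    have hle : n ≤ u.sup id := Finset.le_sup (f := id) hn
    constructor <;> omega
  have hre : ∑ n ∈ u, (((n + M : ℕ) : ℝ) ^ 2)⁻¹ = ∑ i ∈ u.map (addRightEmbedding M), ((i : ℝ) ^ 2)⁻¹ := by
    rw [Finset.sum_map]; rfl
  have hIoo : ∑ i ∈ u.map (addRightEmbedding M), ((i : ℝ) ^ 2)⁻¹ ≤ ∑ i ∈ Finset.Ioo (M - 1) K, ((i : ℝ) ^ 2)⁻¹ :=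
    Finset.sum_le_sum_of_subset_of_nonneg hsub fun i _ _ => by positivity
  have hP := sum_Ioo_inv_sq_le (α := ℝ) (M - 1) K
  have hcast : ((M - 1 : ℕ) : ℝ) + 1 = M := by
    rw [Nat.cast_sub hM]; push_cast; ring
  rw [hcast] at hP
  have hβπ : 0 ≤ β ^ 2 / (4 * π ^ 2) := by positivity
  calc ∑ n ∈ u, 1 / (((2 * ((n + M : ℕ) : ℝ) + 1) * π / β) ^ 2 + ξ ^ 2)
      ≤ β ^ 2 / (4 * π ^ 2) * ∑ n ∈ u, (((n + M : ℕ) : ℝ) ^ 2)⁻¹ := hmaj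
    _ ≤ β ^ 2 / (4 * π ^ 2) * (2 / M) := by
        refine mul_le_mul_of_nonneg_left ?_ hβπ
        rw [hre]; exact hIoo.trans hP
    _ = β ^ 2 / (2 * π ^ 2 * M) := by field_simp; ring

/-- **Truncation from below**: for `ξ > 0` and `M ≥ 1`, `(β/2)·tanh(βξ/2) − ξ·β²/(π²M) ≤ ξ·Σᵢ 1/(ωᵢ² + ξ²)` — the truncated tadpole term is within
`ξβ²/(π²M)` of (`β` times) its midpoint value. -/
theorem half_tanh_sub_le_mul_sum_matsubaraIdx {β ξ : ℝ} (hβ : 0 < β) (hξ : 0 < ξ) {M : ℕ} (hM : 1 ≤ M) :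
    β / 2 * Real.tanh (β * ξ / 2) - ξ * β ^ 2 / (π ^ 2 * M) ≤ ξ * ∑ i : MatsubaraIdx M, 1 / (matsubaraFreq β M i ^ 2 + ξ ^ 2) := by
  rw [sum_matsubaraIdx_one_div_sq_add_sq]
  have hs := summable_one_div_matsubara_sq_add_sq hβ ξ
  have hsplit := hs.sum_add_tsum_nat_add M
  rw [tsum_one_div_matsubara_sq_add_sq hβ hξ.ne'] at hsplit
  have htail := tsum_tail_one_div_matsubara_sq_add_sq_le hβ ξ hM
  -- the tail in `hsplit` is literally the tail bounded in `htail` (cast bookkeeping)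
  have htail' : ∑' n : ℕ, 1 / (((2 * ((n + M : ℕ) : ℝ) + 1) * π / β) ^ 2 + ξ ^ 2) =
      ∑' n : ℕ, 1 / (((2 * (((n + M : ℕ)) : ℝ) + 1) * π / β) ^ 2 + ξ ^ 2) := rfl
  have key : β * Real.tanh (β * ξ / 2) / (4 * ξ) - β ^ 2 / (2 * π ^ 2 * M) ≤
      ∑ n ∈ Finset.range M, 1 / (((2 * n + 1) * π / β) ^ 2 + ξ ^ 2) := by
    have : ∑ n ∈ Finset.range M, 1 / (((2 * (n : ℝ) + 1) * π / β) ^ 2 + ξ ^ 2) =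
        β * Real.tanh (β * ξ / 2) / (4 * ξ) - ∑' n : ℕ, 1 / (((2 * ((n + M : ℕ) : ℝ) + 1) * π / β) ^ 2 + ξ ^ 2) := by
      rw [← hsplit]; push_cast; ring
    rw [this]
    linarith
  have hM0 : (0 : ℝ) < M := by exact_mod_cast hM
  have h2 := mul_le_mul_of_nonneg_left key (show (0 : ℝ) ≤ 2 * ξ by positivity)
  calc β / 2 * Real.tanh (β * ξ / 2) - ξ * β ^ 2 / (π ^ 2 * M)
      = 2 * ξ * (β * Real.tanh (β * ξ / 2) / (4 * ξ) - β ^ 2 / (2 * π ^ 2 * M)) := by field_simp; ring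
    _ ≤ 2 * ξ * ∑ n ∈ Finset.range M, 1 / (((2 * n + 1) * π / β) ^ 2 + ξ ^ 2) := h2
    _ = ξ * (2 * ∑ n ∈ Finset.range M, 1 / (((2 * n + 1) * π / β) ^ 2 + ξ ^ 2)) := by ring

end Summit.HubbardSuperconductivity.HubbardSuperconductivity.Theorems.MatsubaraTadpole

end
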